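import Summits.BirchSwinnertonDyer.BirchSwinnertonDyer.Theorems.AdditiveKolyvaginRoadInductionOfLevelSystems
import Summits.BirchSwinnertonDyer.BirchSwinnertonDyer.Theorems.KolyvaginRoadThreeLevelData
import Literature.NumberTheory.EllipticCurves.HeegnerPointsOfConductorRationalityProofs
import Literature.NumberTheory.EllipticCurves.RingClassGalOverCyclicProofs
import HarnessLib

/-!
# Route `AdditiveKolyvaginRoad`, crux `LevelKolyvaginSystemsAdditive` (item stmt-BirchSwinnertonDyer-21396, KS′):
# the `realisation` field of `LevelKolyvaginSystemP` is SUPPLIED UNCONDITIONALLY — Kolyvagin–Heegner data exist at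
# every Kolyvagin conductor (cell `pub/bsd-wall`, lead prover `bsd-wall-akr-p2x` g0, line `birth`;
# `--supports stmt-BirchSwinnertonDyer-21396`, helper)

WHAT. The carrier `LevelKolyvaginSystemP W K p Dt β ι c` of the crux (`Theorems/AdditiveKolyvaginRoadLevelSystems.lean`)
asks, at level `n = ∅`, that the classes `κ m ∅` BE the frame's Kolyvagin classes mod `p`: `∃ d : KolyvaginHeegnerData Dt β
ι (∏ m), κ m ∅ = d.kolyvaginClass _ 1` (field `realisation`). Any inhabitant therefore needs a Kolyvagin–Heegner datum of
conductor `∏ m` for EVERY finite set `m` of Kolyvagin primes. This file discharges that once and for all, with NO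
hypothesis beyond the frame's: `K` imaginary quadratic, Heegner for `N = W.conductorNorm ℤ`, `4N ∣ β² − d_K`.

* `nonempty_kolyvaginHeegnerData_finsetProd` — `Nonempty (KolyvaginHeegnerData Dt β ι (∏ ℓ ∈ m, ℓ))` for every finite
  set `m` of Kolyvagin primes (`Zhang2014.IsKolyvaginPrime`): the product is square-free with inert prime factors
  (`Method2.kolSupp_finsetProd`; a Kolyvagin prime is inert by definition), so the tree's constructor
  `nonempty_kolyvaginHeegnerData_of_grossCM` (koly, `KolyvaginRoadThreeLevelData`) applies, fed with the two CM facts of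
  Gross 1991 §3 — both PROVED in the tree: `phi_heegnerPointOfConductor_mem_range_map_ringClassField_holds` (the
  Heegner point `y(n) = φ(x(n))` is `K[n]`-rational) and `exists_generator_ringClassGalOver_holds` (each
  `G_ℓ = Gal(K[n]/K[n/ℓ])` is cyclic).
* `exists_realisation` — hence a level-`∅` family `κ₀ m := (some datum of conductor ∏ m).kolyvaginClass _ 1` with the
  `realisation` property VERBATIM exists; every line for KS′ may take the bottom row of the system from here.

HONEST FRAMING: two theorems; 0 definitions, 0 named facts, 0 `sorry`; UNCONDITIONAL (the two CM facts are discharged in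
the tree); closes nothing — the open mathematics of KS′ sits at the NON-EMPTY levels (`transport`, `baseCase`). BSD is
not proved by any of this.

References: [cite: GrossLMS1991, §3 (pp. 238–239: x_n rational over K_n; G_ℓ cyclic), §4 (4.1)] [cite: WZhang2014, §3.7
(3.21)–(3.22)].
-/

-- single-conjunct summit: `Summit.BirchSwinnertonDyer.BirchSwinnertonDyer.…` repeats the name by design
set_option linter.dupNamespace false

noncomputable section

open scoped Classical

namespace Summit.BirchSwinnertonDyer.BirchSwinnertonDyer.Theorems.AdditiveKoly

open WeierstrassCurve NumberField IsDedekindDomain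
  Literature.NumberTheory.EllipticCurves Literature.NumberTheory.EllipticCurves.ModularForms
  Summit.BirchSwinnertonDyer.Rank1Residual.X11b.Three.Koly

variable (W : WeierstrassCurve ℚ) (K : Type) [Field K] [NumberField K] (p : ℕ)
  [W.IsElliptic] [W.IsGloballyMinimal] [NeZero (W.conductorNorm ℤ)]

/-- **Kolyvagin–Heegner data exist at every Kolyvagin conductor** (Gross 1991 §3–§4), unconditionally: for `E/ℚ`
elliptic with globally minimal model `W`, `K` imaginary quadratic and Heegner for `N = N_E`, a parametrisation datum
`Dt`, an orientation `β` with `4N ∣ β² − d_K`, an embedding `ι : K → ℂ`, and ANY finite set `m` of Kolyvagin primes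
(`Zhang2014.IsKolyvaginPrime N W K p`), the type `KolyvaginHeegnerData Dt β ι (∏ ℓ ∈ m, ℓ)` is inhabited. The
conductor `∏ m` is square-free with prime factors inert in `K` (`Method2.kolSupp_finsetProd`), and the two CM inputs of
the tree's constructor `nonempty_kolyvaginHeegnerData_of_grossCM` are the PROVED facts
`phi_heegnerPointOfConductor_mem_range_map_ringClassField_holds` and `exists_generator_ringClassGalOver_holds`.
[cite: GrossLMS1991, §3 (pp. 238–239), §4 (4.1)] -/
theorem nonempty_kolyvaginHeegnerData_finsetProd (hK : IsImaginaryQuadratic K)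
    (hH : SatisfiesHeegnerHypothesis (W.conductorNorm ℤ) K)
    (Dt : ModularParametrizationData W (W.conductorNorm ℤ)) (β : ℤ) (ι : K →+* ℂ)
    (hβ : (4 * (W.conductorNorm ℤ : ℤ)) ∣ β ^ 2 - NumberField.discr K)
    (m : Finset {ℓ // Zhang2014.IsKolyvaginPrime (W.conductorNorm ℤ) W K p ℓ}) :
    Nonempty (KolyvaginHeegnerData Dt β ι (∏ ℓ ∈ m, (ℓ : ℕ))) := by
  have hsupp := Method2.kolSupp_finsetProd
    (Kol := Zhang2014.IsKolyvaginPrime (W.conductorNorm ℤ) W K p) (fun ℓ h ↦ h.1) m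
  exact nonempty_kolyvaginHeegnerData_of_grossCM
    (phi_heegnerPointOfConductor_mem_range_map_ringClassField_holds (W.conductorNorm ℤ) W K)
    exists_generator_ringClassGalOver_holds hK hH Dt β ι hβ hsupp.1 (fun q hq ↦ (hsupp.2 q hq).2.2.2.2.1)

/-- **The `realisation` row of a level Kolyvagin system exists**: a level-`∅` family of classes
`κ₀ m ∈ H¹(K, E[p])`, `m` ranging over the finite sets of Kolyvagin primes, each of which IS the Kolyvagin class mod `p`
(`d.kolyvaginClass _ 1`, `c_1(∏ m)` of Gross (4.4) ∕ W. Zhang (3.21)) of some Kolyvagin–Heegner datum `d` of conductor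
`∏ m` — the field `LevelKolyvaginSystemP.realisation` verbatim. Unconditional at every frame. [cite: WZhang2014, §3.7
(3.21)] [cite: GrossLMS1991, §4 (4.4)] -/
theorem exists_realisation [Fact p.Prime] (hK : IsImaginaryQuadratic K)
    (hH : SatisfiesHeegnerHypothesis (W.conductorNorm ℤ) K)
    (Dt : ModularParametrizationData W (W.conductorNorm ℤ)) (β : ℤ) (ι : K →+* ℂ)
    (hβ : (4 * (W.conductorNorm ℤ : ℤ)) ∣ β ^ 2 - NumberField.discr K) :
    ∃ κ₀ : Finset {ℓ // Zhang2014.IsKolyvaginPrime (W.conductorNorm ℤ) W K p ℓ} → Vp W K p,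
      ∀ m : Finset {ℓ // Zhang2014.IsKolyvaginPrime (W.conductorNorm ℤ) W K p ℓ},
        ∃ d : KolyvaginHeegnerData Dt β ι (∏ ℓ ∈ m, (ℓ : ℕ)),
          κ₀ m = d.kolyvaginClass (Fact.out : p.Prime) 1 :=
  ⟨fun m ↦ (Classical.choice (nonempty_kolyvaginHeegnerData_finsetProd W K p hK hH Dt β ι hβ m)).kolyvaginClass
      (Fact.out : p.Prime) 1,
    fun _ ↦ ⟨_, rfl⟩⟩

end Summit.BirchSwinnertonDyer.BirchSwinnertonDyer.Theorems.AdditiveKoly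

end
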